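/-
Copyright (c) 2026. All rights reserved.
Released under Apache 2.0 license as described in the file LICENSE.
-/
import Mathlib
import HarnessLib
import Literature.MathematicalPhysics.QuantumLattice.GaugeGroups
import Literature.MathematicalPhysics.QuantumFieldTheory.ConstructiveQFTWave0
import Literature.MathematicalPhysics.QuantumFieldTheory.LatticeGaugeProofs
import Literature.MathematicalPhysics.QuantumFieldTheory.U1GinibreComparison
import Literature.MathematicalPhysics.QuantumLattice.AbelianFieldTensor
import Literature.MathematicalPhysics.QuantumLattice.AbelianMagneticFlux
import Summits.Ventures.LatticeQCDFlow.Exactness.SymmetricMetropolis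
import Summits.Ventures.LatticeQCDFlow.Exactness.CompactHaar
import Summits.Ventures.LatticeQCDFlow.Scaling.LatticePeeling
import Summits.Ventures.LatticeQCDFlow.Scaling.SliceTwistWitness
import Summits.Ventures.LatticeQCDFlow.Scaling.FluxTunnellingU1Explicit
import Summits.Ventures.LatticeQCDFlow.Scaling.BoxSpreadWitness
import Summits.Ventures.LatticeQCDFlow.Scaling.BoxTouch
import Summits.Ventures.LatticeQCDFlow.Scaling.FluxTunnellingU1MaxPlaquette
import Summits.Ventures.LatticeQCDFlow.Scaling.FluxInsertionKernel
import Summits.Ventures.LatticeQCDFlow.Scaling.FluxInsertionBox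
import Summits.Ventures.LatticeQCDFlow.Scaling.ConvolutionPowerCompensation
import Summits.Ventures.LatticeQCDFlow.Scaling.FluxInsertionSharpFloor
import Summits.Ventures.LatticeQCDFlow.Scaling.FluxInsertionSharpFloorInstances
import Summits.Ventures.LatticeQCDFlow.Scaling.FluxInsertionSharpRate
import Literature.MathematicalPhysics.QuantumFieldTheory.TorusFreeTransfer
import Summits.Ventures.LatticeQCDFlow.Scaling.FluxInsertionHeightIdentity

/-!
# The min–max height LAW: the fixed-volume tunnelling rate of an insertion kernel (item 106b)

HONEST FRAMING: exact (Metropolis-corrected) sampling algorithms for lattice gauge theory;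
figures of merit are autocorrelation/cost numbers at stated couplings and volumes; no
continuum-physics claim.

Venture `LatticeQCDFlow` (cell pub-lqcd), topic `Scaling`, FANOUT row 29 (theory2, gen-20), item 106b
(imports item 106a).  NEW WORK; nothing here is cited as a fact.  `U(1)`, Wilson action `S ≥ 0`,
torus `(ℤ/L)^d`, `μ_β = wilsonMeasure u1Rep β`, `Q = Flux.topCharge x₀ μ ν`, `K_W` = gen-19's
insertion kernel (item 98), Haar = product Haar probability measure.

**The law** (every `W`, every volume, every base plaquette; no invariance or locality used).  Let
`H_X = ess inf_{Haar | Q(XU) ≠ Q(U)} max(S(U), S(XU)) ∈ [0, ∞]` (`insHeight`) and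
`H = min(H_W, H_{W⁻¹})` (`insHeight₂`).  If `H < ∞` then for every `ε > 0`, eventually in `β`,
  `e^{−β(H + ε)} ≤ (μ_β ⊗ K_W){Q ≠ Q'} ≤ e^{−β(H − ε)}`
(`insertion_height_law`), i.e. `lim_{β→∞} −(1/β) log (μ_β ⊗ K_W){Q ≠ Q'} = H` EXISTS and equals
the essential min–max action height of the charge-changing insertions (if `H = ∞` the probability
is `0` for every `β ≥ 0`, `insProb_eq_zero_of_height_eq_top`).  Proof: the exact identity of item
106a, `Z_β ≤ 1`, `Z_β ≥ e^{−βε} Haar{S ≤ ε}` with `Haar{S ≤ ε} > 0`, and the two generic Laplace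
bounds through the essential infimum.

**The block kernel** (`d = 2`, `W = boxSpread l`, `Q = topCharge 0 0 1`, `N = (l+1)² − 4`,
`2 ≤ l`, `l + 1 ≤ L`; `boxHeight l L = H`):  `boxHeight_ne_top`; the fixed-volume rate of
`P_{β,l,L} = boxTunnelProb β l L` IS `E(l,L) = (boxHeight l L).toReal` (`u1_boxInsertion_height_law`,
every parity); and from items 105/97, `N(1 − cos(π/N)) ≤ E(l,L)` (`L` even, `boxHeight_ge`) and
`E(l,L) ≤ N(1 − cos(π/N)) + (L²−N)(1 − cos(π/(L²−N−1)))` (`boxHeight_le`), hence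
`E(l,L) → N(1 − cos(π/N))` as `L → ∞` through even `L` (`boxHeight_largeVolume`).  So conjecture C9″
of THEORY-2.md (the fixed-`L` rate) is EQUIVALENT to the finite-dimensional variational statement
`E(l,L) = N(1 − cos(π/N)) + (L²−N)(1 − cos(π/(L²−N)))` about an essential infimum; it is not
decided here.  Five `def`s (`insHeight`, `insHeight₂`, `insProb`, `insIntegral`, `boxHeight`).
-/

noncomputable section

open MeasureTheory ProbabilityTheory Filter Topology Real
open scoped ENNReal
open Literature.MathematicalPhysics.QuantumFieldTheory Literature.MathematicalPhysics.QuantumLattice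
open Summit.Ventures.LatticeQCDFlow.Exactness

namespace Summit.Ventures.LatticeQCDFlow.Theory2.Lattice.Flux

/-! ## §1 Heights and the tunnelling probability of a general insertion kernel -/

section General

variable {d L : ℕ} [NeZero L]

/-- The essential min–max height of the insertion `X`:
`ess inf_{Haar | Q(XU) ≠ Q(U)} max(S(U), S(XU))`. [folklore] -/
def insHeight (X : GaugeConfig d L Circle) (x₀ : Site d L) (μ' ν' : Fin d) : ℝ≥0∞ :=
  essHeight (u1Haar d L) {U | topCharge x₀ μ' ν' (X * U) ≠ topCharge x₀ μ' ν' U}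
    fun U => max (wilsonAction u1Rep U) (wilsonAction u1Rep (X * U))

/-- The height of the two-sided kernel: `min(H_W, H_{W⁻¹})`. [folklore] -/
def insHeight₂ (W : GaugeConfig d L Circle) (x₀ : Site d L) (μ' ν' : Fin d) : ℝ≥0∞ :=
  min (insHeight W x₀ μ' ν') (insHeight W⁻¹ x₀ μ' ν')

/-- The equilibrium probability that one step of `K_W` changes the charge. [folklore] -/
def insProb (β : ℝ) (W : GaugeConfig d L Circle) (x₀ : Site d L) (μ' ν' : Fin d) : ℝ≥0∞ :=
  ((wilsonMeasure u1Rep β) ⊗ₘ insertionMH W (u1Weight β))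
    {q | topCharge x₀ μ' ν' q.1 ≠ topCharge x₀ μ' ν' q.2}

/-- The Laplace integral of the insertion `X`. [folklore] -/
def insIntegral (β : ℝ) (X : GaugeConfig d L Circle) (x₀ : Site d L) (μ' ν' : Fin d) : ℝ≥0∞ :=
  ∫⁻ U in {U | topCharge x₀ μ' ν' (X * U) ≠ topCharge x₀ μ' ν' U},
    ENNReal.ofReal (Real.exp (-(β * max (wilsonAction u1Rep U) (wilsonAction u1Rep (X * U)))))
      ∂(u1Haar d L)

/-- Item 106a's identity in this notation. [folklore] -/
theorem insProb_eq {β : ℝ} (hβ : 0 ≤ β) (W : GaugeConfig d L Circle) (x₀ : Site d L)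
    (μ' ν' : Fin d) :
    insProb β W x₀ μ' ν' = (partitionFunction (d := d) (L := L) u1Rep β)⁻¹ *
      (2⁻¹ * (insIntegral β W x₀ μ' ν' + insIntegral β W⁻¹ x₀ μ' ν')) :=
  wilson_compProd_insertionMH_topCharge_ne_eq hβ W x₀ μ' ν'

/-- `insProb ≤ 1`. [folklore] -/
theorem insProb_le_one (β : ℝ) (W : GaugeConfig d L Circle) (x₀ : Site d L) (μ' ν' : Fin d) :
    insProb β W x₀ μ' ν' ≤ 1 := by
  haveI : IsProbabilityMeasure (wilsonMeasure (d := d) (L := L) u1Rep β) :=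
    isProbabilityMeasure_wilsonMeasure u1Rep continuous_u1Rep β
  haveI : Fact (Measurable (u1Weight (d := d) (L := L) β)) := ⟨measurable_u1Weight β⟩
  exact prob_le_one

/-- Upper Laplace bound for one insertion: `I_X ≤ e^{−βE}` for every finite `E ≤ H_X`. [folklore] -/
theorem insIntegral_le {β : ℝ} (hβ : 0 ≤ β) (X : GaugeConfig d L Circle) (x₀ : Site d L)
    (μ' ν' : Fin d) {E : ℝ≥0∞} (hE : E ≤ insHeight X x₀ μ' ν') (hEt : E ≠ ⊤) :
    insIntegral β X x₀ μ' ν' ≤ ENNReal.ofReal (Real.exp (-(β * E.toReal))) := by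
  refine (setLIntegral_exp_le_of_le_essHeight (u1Haar d L) _ _ hβ
    (fun U => (wilsonAction_u1_nonneg U).trans (le_max_left _ _)) hE hEt).trans ?_
  exact mul_le_of_le_one_right bot_le prob_le_one

/-- An infinite height kills the integral. [folklore] -/
theorem insIntegral_eq_zero_of_top (β : ℝ) (X : GaugeConfig d L Circle) (x₀ : Site d L)
    (μ' ν' : Fin d) (h : insHeight X x₀ μ' ν' = ⊤) : insIntegral β X x₀ μ' ν' = 0 := by
  have hz := restrict_eq_zero_of_essHeight_eq_top (u1Haar d L) _ _ h
  unfold insIntegral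
  rw [hz, lintegral_zero_measure]

/-- **Ceiling**: `insProb ≤ Z⁻¹ e^{−βH}` (`H = insHeight₂ < ∞`, `β ≥ 0`). [folklore] -/
theorem insProb_le {β : ℝ} (hβ : 0 ≤ β) (W : GaugeConfig d L Circle) (x₀ : Site d L)
    (μ' ν' : Fin d) (hH : insHeight₂ W x₀ μ' ν' ≠ ⊤) :
    insProb β W x₀ μ' ν' ≤ (partitionFunction (d := d) (L := L) u1Rep β)⁻¹ *
      ENNReal.ofReal (Real.exp (-(β * (insHeight₂ W x₀ μ' ν').toReal))) := by
  rw [insProb_eq hβ]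
  refine mul_le_mul_right ?_ _
  have h1 := insIntegral_le hβ W x₀ μ' ν' (min_le_left _ _ : insHeight₂ W x₀ μ' ν' ≤ _) hH
  have h2 := insIntegral_le hβ W⁻¹ x₀ μ' ν' (min_le_right _ _ : insHeight₂ W x₀ μ' ν' ≤ _) hH
  calc 2⁻¹ * (insIntegral β W x₀ μ' ν' + insIntegral β W⁻¹ x₀ μ' ν')
      ≤ 2⁻¹ * (ENNReal.ofReal (Real.exp (-(β * (insHeight₂ W x₀ μ' ν').toReal))) +
          ENNReal.ofReal (Real.exp (-(β * (insHeight₂ W x₀ μ' ν').toReal)))) :=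
        mul_le_mul_right (add_le_add h1 h2) _
    _ = ENNReal.ofReal (Real.exp (-(β * (insHeight₂ W x₀ μ' ν').toReal))) := by
        rw [← two_mul, ← mul_assoc, ENNReal.inv_mul_cancel two_ne_zero ENNReal.ofNat_ne_top, one_mul]

/-- **The probability vanishes iff the height is infinite** (one direction): `H = ∞ ⇒ insProb = 0`
for every `β ≥ 0`. [folklore] -/
theorem insProb_eq_zero_of_height_eq_top {β : ℝ} (hβ : 0 ≤ β) (W : GaugeConfig d L Circle)
    (x₀ : Site d L) (μ' ν' : Fin d) (h : insHeight₂ W x₀ μ' ν' = ⊤) : insProb β W x₀ μ' ν' = 0 := by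
  have h1 : insHeight W x₀ μ' ν' = ⊤ :=
    top_le_iff.mp (h.symm.le.trans (min_le_left _ _ : insHeight₂ W x₀ μ' ν' ≤ _))
  have h2 : insHeight W⁻¹ x₀ μ' ν' = ⊤ :=
    top_le_iff.mp (h.symm.le.trans (min_le_right _ _ : insHeight₂ W x₀ μ' ν' ≤ _))
  rw [insProb_eq hβ, insIntegral_eq_zero_of_top β W x₀ μ' ν' h1,
    insIntegral_eq_zero_of_top β W⁻¹ x₀ μ' ν' h2, add_zero, mul_zero, mul_zero]

/-- **Floor** for one insertion `X ∈ {W, W⁻¹}` of finite height: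
`e^{−β(H_X + ε)} · ½ Haar(A_X ∩ {f_X < H_X + ε}) ≤ insProb` (`β ≥ 0`). [folklore] -/
theorem insProb_ge {β : ℝ} (hβ : 0 ≤ β) (W X : GaugeConfig d L Circle) (hX : X = W ∨ X = W⁻¹)
    (x₀ : Site d L) (μ' ν' : Fin d) (ε : ℝ) :
    ENNReal.ofReal (Real.exp (-(β * ((insHeight X x₀ μ' ν').toReal + ε)))) *
        (2⁻¹ * ((u1Haar d L).restrict {U | topCharge x₀ μ' ν' (X * U) ≠ topCharge x₀ μ' ν' U})
          {U | max (wilsonAction u1Rep U) (wilsonAction u1Rep (X * U)) <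
            (insHeight X x₀ μ' ν').toReal + ε}) ≤
      insProb β W x₀ μ' ν' := by
  have hm : Measurable fun U : GaugeConfig d L Circle =>
      max (wilsonAction u1Rep U) (wilsonAction u1Rep (X * U)) :=
    (measurable_wilsonAction u1Rep continuous_u1Rep).max
      ((measurable_wilsonAction u1Rep continuous_u1Rep).comp (measurable_const_mul X))
  have hL := setLIntegral_exp_ge_essHeight (u1Haar d L)
    {U | topCharge x₀ μ' ν' (X * U) ≠ topCharge x₀ μ' ν' U} _ hβ hm ε
  have hZ : 1 ≤ (partitionFunction (d := d) (L := L) u1Rep β)⁻¹ :=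
    ENNReal.one_le_inv.mpr (partitionFunction_u1_le_one hβ)
  have hXI : insIntegral β X x₀ μ' ν' ≤ insIntegral β W x₀ μ' ν' + insIntegral β W⁻¹ x₀ μ' ν' := by
    rcases hX with h | h
    · rw [h]; exact le_self_add
    · rw [h]; exact le_add_self
  rw [insProb_eq hβ, mul_left_comm]
  calc 2⁻¹ * (ENNReal.ofReal (Real.exp (-(β * ((insHeight X x₀ μ' ν').toReal + ε)))) * _)
      ≤ 2⁻¹ * insIntegral β X x₀ μ' ν' := mul_le_mul_right hL _
    _ ≤ 2⁻¹ * (insIntegral β W x₀ μ' ν' + insIntegral β W⁻¹ x₀ μ' ν') := mul_le_mul_right hXI _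
    _ = 1 * (2⁻¹ * (insIntegral β W x₀ μ' ν' + insIntegral β W⁻¹ x₀ μ' ν')) := (one_mul _).symm
    _ ≤ _ := mul_le_mul_left hZ _

/-! ## §2 The law in `ε`-form -/

/-- If `0 < m` then eventually `m⁻¹ ≤ e^{βε/2}` (`ε > 0`). [folklore] -/
theorem eventually_inv_le_exp {ε m : ℝ} (hε : 0 < ε) (hm : 0 < m) :
    ∀ᶠ β : ℝ in atTop, m⁻¹ ≤ Real.exp (β * (ε / 2)) := by
  filter_upwards [eventually_ge_atTop (2 * Real.log m⁻¹ / ε)] with β hβ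
  have h1 : Real.log m⁻¹ ≤ β * (ε / 2) := by
    rw [div_le_iff₀ hε] at hβ; linarith
  calc m⁻¹ = Real.exp (Real.log m⁻¹) := (Real.exp_log (inv_pos.mpr hm)).symm
    _ ≤ _ := Real.exp_le_exp.mpr h1

/-- **The min–max height law.**  If `H = insHeight₂ W < ∞` then for every `ε > 0`, eventually in
`β`, `e^{−β(H + ε)} ≤ (μ_β ⊗ K_W){Q ≠ Q'} ≤ e^{−β(H − ε)}`. [folklore] -/
theorem insertion_height_law (W : GaugeConfig d L Circle) (x₀ : Site d L) (μ' ν' : Fin d)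
    (hH : insHeight₂ W x₀ μ' ν' ≠ ⊤) {ε : ℝ} (hε : 0 < ε) :
    ∀ᶠ β : ℝ in atTop,
      Real.exp (-(β * ((insHeight₂ W x₀ μ' ν').toReal + ε))) ≤ (insProb β W x₀ μ' ν').toReal ∧
        (insProb β W x₀ μ' ν').toReal ≤
          Real.exp (-(β * ((insHeight₂ W x₀ μ' ν').toReal - ε))) := by
  -- the insertion achieving the minimum
  obtain ⟨X, hX, hHX⟩ : ∃ X, (X = W ∨ X = W⁻¹) ∧
      insHeight X x₀ μ' ν' = insHeight₂ W x₀ μ' ν' := by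
    rcases le_total (insHeight W x₀ μ' ν') (insHeight W⁻¹ x₀ μ' ν') with h | h
    · exact ⟨W, Or.inl rfl, (min_eq_left h).symm⟩
    · exact ⟨W⁻¹, Or.inr rfl, (min_eq_right h).symm⟩
  have hHXt : insHeight X x₀ μ' ν' ≠ ⊤ := hHX ▸ hH
  -- the floor constant `½ Haar(A_X ∩ {f_X < H_X + ε/2}) ∈ (0, ∞)`
  have hmEpos : 0 < 2⁻¹ * ((u1Haar d L).restrict
      {U | topCharge x₀ μ' ν' (X * U) ≠ topCharge x₀ μ' ν' U})
      {U | max (wilsonAction u1Rep U) (wilsonAction u1Rep (X * U)) <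
        (insHeight X x₀ μ' ν').toReal + ε / 2} :=
    ENNReal.mul_pos (ENNReal.inv_ne_zero.mpr ENNReal.ofNat_ne_top)
      (measure_lt_essHeight_add_pos (u1Haar d L) _ _ (half_pos hε) hHXt).ne'
  have hmEtop : 2⁻¹ * ((u1Haar d L).restrict
      {U | topCharge x₀ μ' ν' (X * U) ≠ topCharge x₀ μ' ν' U})
      {U | max (wilsonAction u1Rep U) (wilsonAction u1Rep (X * U)) <
        (insHeight X x₀ μ' ν').toReal + ε / 2} ≠ ⊤ :=
    ENNReal.mul_ne_top (ENNReal.inv_ne_top.mpr two_ne_zero) (measure_lt_top _ _).ne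
  have hmr := ENNReal.toReal_pos hmEpos.ne' hmEtop
  -- the ceiling constant `Haar{S ≤ ε/2} ∈ (0, ∞)`
  have hh0pos : 0 < (u1Haar d L) {U | wilsonAction u1Rep U ≤ ε / 2} :=
    u1Haar_action_le_pos (half_pos hε)
  have hh0top : (u1Haar d L) {U | wilsonAction u1Rep U ≤ ε / 2} ≠ ⊤ := (measure_lt_top _ _).ne
  have hh0r := ENNReal.toReal_pos hh0pos.ne' hh0top
  filter_upwards [eventually_ge_atTop (0 : ℝ), eventually_inv_le_exp hε hmr,
    eventually_inv_le_exp hε hh0r] with β hβ hF hC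
  have hPt : insProb β W x₀ μ' ν' ≠ ⊤ :=
    ((insProb_le_one β W x₀ μ' ν').trans_lt ENNReal.one_lt_top).ne
  constructor
  · -- floor
    have h2 := ENNReal.toReal_mono hPt (insProb_ge hβ W X hX x₀ μ' ν' (ε / 2))
    rw [ENNReal.toReal_mul, ENNReal.toReal_ofReal (Real.exp_nonneg _)] at h2
    rw [← hHX]
    calc Real.exp (-(β * ((insHeight X x₀ μ' ν').toReal + ε)))
        = Real.exp (-(β * ((insHeight X x₀ μ' ν').toReal + ε / 2))) *
            (Real.exp (β * (ε / 2)))⁻¹ := by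
          rw [← Real.exp_neg, ← Real.exp_add]; congr 1; ring
      _ ≤ Real.exp (-(β * ((insHeight X x₀ μ' ν').toReal + ε / 2))) * _ :=
          mul_le_mul_of_nonneg_left (inv_le_of_inv_le₀ hmr hF) (Real.exp_nonneg _)
      _ ≤ _ := h2
  · -- ceiling
    have hZ := partitionFunction_u1_ge (d := d) (L := L) hβ (ε / 2)
    have hpos : 0 < Real.exp (-(β * (ε / 2))) *
        ((u1Haar d L) {U | wilsonAction u1Rep U ≤ ε / 2}).toReal := by positivity
    have hZpos : 0 < partitionFunction (d := d) (L := L) u1Rep β :=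
      lt_of_lt_of_le (ENNReal.mul_pos (by positivity) hh0pos.ne') hZ
    have hZtop : partitionFunction (d := d) (L := L) u1Rep β ≠ ⊤ :=
      ((partitionFunction_u1_le_one hβ).trans_lt ENNReal.one_lt_top).ne
    have hZr_pos : 0 < (partitionFunction (d := d) (L := L) u1Rep β).toReal :=
      ENNReal.toReal_pos hZpos.ne' hZtop
    have hZr : Real.exp (-(β * (ε / 2))) * ((u1Haar d L) {U | wilsonAction u1Rep U ≤ ε / 2}).toReal ≤
        (partitionFunction (d := d) (L := L) u1Rep β).toReal := by
      have := ENNReal.toReal_mono hZtop hZ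
      rwa [ENNReal.toReal_mul, ENNReal.toReal_ofReal (Real.exp_nonneg _)] at this
    have h1 := ENNReal.toReal_mono (ENNReal.mul_ne_top (ENNReal.inv_ne_top.mpr hZpos.ne')
      ENNReal.ofReal_ne_top) (insProb_le hβ W x₀ μ' ν' hH)
    rw [ENNReal.toReal_mul, ENNReal.toReal_inv, ENNReal.toReal_ofReal (Real.exp_nonneg _)] at h1
    calc (insProb β W x₀ μ' ν').toReal
        ≤ ((partitionFunction (d := d) (L := L) u1Rep β).toReal)⁻¹ *
            Real.exp (-(β * (insHeight₂ W x₀ μ' ν').toReal)) := h1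
      _ ≤ (Real.exp (-(β * (ε / 2))) *
            ((u1Haar d L) {U | wilsonAction u1Rep U ≤ ε / 2}).toReal)⁻¹ *
            Real.exp (-(β * (insHeight₂ W x₀ μ' ν').toReal)) :=
          mul_le_mul_of_nonneg_right ((inv_le_inv₀ hZr_pos hpos).mpr hZr) (Real.exp_nonneg _)
      _ = Real.exp (β * (ε / 2)) *
            (((u1Haar d L) {U | wilsonAction u1Rep U ≤ ε / 2}).toReal)⁻¹ *
            Real.exp (-(β * (insHeight₂ W x₀ μ' ν').toReal)) := by
          rw [mul_inv, ← Real.exp_neg, neg_neg]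
      _ ≤ Real.exp (β * (ε / 2)) * Real.exp (β * (ε / 2)) *
            Real.exp (-(β * (insHeight₂ W x₀ μ' ν').toReal)) :=
          mul_le_mul_of_nonneg_right (mul_le_mul_of_nonneg_left hC (Real.exp_nonneg _))
            (Real.exp_nonneg _)
      _ = Real.exp (-(β * ((insHeight₂ W x₀ μ' ν').toReal - ε))) := by
          rw [← Real.exp_add, ← Real.exp_add]; congr 1; ring

end General

/-! ## §3 The block kernel: the fixed-volume rate is the height, sandwiched by items 105 / 97 -/

section Box

variable {l L : ℕ} [NeZero L]

variable (l L) in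
/-- The min–max height of the block-insertion kernel. [folklore] -/
def boxHeight : ℝ≥0∞ := insHeight₂ (boxSpread (L := L) l) (0 : Site 2 L) 0 1

/-- `boxTunnelProb` is `insProb` of the block spread. [folklore] -/
theorem boxTunnelProb_eq (β : ℝ) :
    boxTunnelProb β l L = (insProb β (boxSpread (L := L) l) (0 : Site 2 L) 0 1).toReal := rfl

/-- If `e^{−β(a+ε)} ≤ e^{−β(b−ε)}` eventually for every `ε > 0` then `b ≤ a`. [folklore] -/
theorem le_of_eventually_exp_le {a b : ℝ}
    (h : ∀ ε : ℝ, 0 < ε → ∀ᶠ β : ℝ in atTop,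
      Real.exp (-(β * (a + ε))) ≤ Real.exp (-(β * (b - ε)))) : b ≤ a := by
  by_contra hab
  have hab' : a < b := not_le.mp hab
  have hε : 0 < (b - a) / 4 := by linarith
  obtain ⟨β, hβ1, hβ0⟩ := ((h _ hε).and (eventually_gt_atTop 0)).exists
  rw [Real.exp_le_exp, neg_le_neg_iff] at hβ1
  have := le_of_mul_le_mul_left hβ1 hβ0
  linarith

/-- **The block height is finite** (from the floor of item 105). [folklore] -/
theorem boxHeight_ne_top (hl : 2 ≤ l) (hlL : l + 1 ≤ L) : boxHeight l L ≠ ⊤ := by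
  intro h
  obtain ⟨β, hβ1, hβ0⟩ :=
    ((u1_boxInsertion_rate_floor hl hlL one_pos).and (eventually_ge_atTop 0)).exists
  rw [boxTunnelProb_eq, insProb_eq_zero_of_height_eq_top hβ0 _ _ _ _ h, ENNReal.toReal_zero] at hβ1
  exact absurd hβ1 (not_le.mpr (Real.exp_pos _))

/-- **The fixed-volume rate of the block kernel is its min–max height**: for every `ε > 0`,
eventually in `β`, `e^{−β(E + ε)} ≤ P_{β,l,L} ≤ e^{−β(E − ε)}` with `E = (boxHeight l L).toReal`
(`2 ≤ l`, `l + 1 ≤ L`, every parity). [folklore] -/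
theorem u1_boxInsertion_height_law (hl : 2 ≤ l) (hlL : l + 1 ≤ L) {ε : ℝ} (hε : 0 < ε) :
    ∀ᶠ β : ℝ in atTop,
      Real.exp (-(β * ((boxHeight l L).toReal + ε))) ≤ boxTunnelProb β l L ∧
        boxTunnelProb β l L ≤ Real.exp (-(β * ((boxHeight l L).toReal - ε))) :=
  insertion_height_law (boxSpread (L := L) l) (0 : Site 2 L) 0 1 (boxHeight_ne_top hl hlL) hε

/-- **Lower bound on the height** (item 97's necessity law, through item 105's ceiling):
`N(1 − cos(π/N)) ≤ E(l,L)` for even `L`. [folklore] -/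
theorem boxHeight_ge (hl : 2 ≤ l) (hlL : l + 1 ≤ L) (hLe : Even L) :
    (((l + 1) * (l + 1) - 4 : ℕ) : ℝ) * (1 - Real.cos (boxAlpha l / 2)) ≤ (boxHeight l L).toReal := by
  refine le_of_eventually_exp_le fun ε hε => ?_
  filter_upwards [u1_boxInsertion_height_law hl hlL hε, u1_boxInsertion_rate_ceiling hl hlL hLe hε]
    with β h1 h2
  exact h1.1.trans h2

/-- **Upper bound on the height** (item 105's fixed-volume floor):
`E(l,L) ≤ N(1 − cos(π/N)) + (L²−N)(1 − cos(π/(L²−N−1)))`. [folklore] -/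
theorem boxHeight_le (hl : 2 ≤ l) (hlL : l + 1 ≤ L) :
    (boxHeight l L).toReal ≤
      (((l + 1) * (l + 1) - 4 : ℕ) : ℝ) * (1 - Real.cos (boxAlpha l / 2)) +
        ((L ^ 2 - ((l + 1) * (l + 1) - 4) : ℕ) : ℝ) *
          (1 - Real.cos (π / ((L ^ 2 - ((l + 1) * (l + 1) - 4) - 1 : ℕ) : ℝ))) := by
  refine le_of_eventually_exp_le fun ε hε => ?_
  filter_upwards [u1_boxInsertion_rate_floor hl hlL hε, u1_boxInsertion_height_law hl hlL hε]
    with β h1 h2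
  exact h1.trans h2.2

/-- **The height converges to the open-boundary value**: for every `ε > 0` there is `L₀` such
that `|E(l,L) − N(1 − cos(π/N))| ≤ ε` for every even `L ≥ L₀`. [folklore] -/
theorem boxHeight_largeVolume (hl : 2 ≤ l) {ε : ℝ} (hε : 0 < ε) :
    ∃ L₀ : ℕ, ∀ (L : ℕ) [NeZero L], L₀ ≤ L → Even L →
      |(boxHeight l L).toReal -
          (((l + 1) * (l + 1) - 4 : ℕ) : ℝ) * (1 - Real.cos (boxAlpha l / 2))| ≤ ε := by
  obtain ⟨T, hT⟩ := exists_nat_ge (π ^ 2 / ε)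
  refine ⟨(l + 1) * (l + 1) + T + (l + 1), fun L _ hL hLe => ?_⟩
  have hlL : l + 1 ≤ L := by omega
  have hLL : L ≤ L ^ 2 := by rw [sq]; exact Nat.le_mul_self L
  set N : ℕ := (l + 1) * (l + 1) - 4 with hN
  set M : ℕ := L ^ 2 - N with hM
  have hM2 : 2 + T ≤ M := by omega
  have hvol : (M : ℝ) * (1 - Real.cos (π / ((M - 1 : ℕ) : ℝ))) ≤ ε := by
    refine le_trans (volumeTerm_le (by omega)) ?_
    have hM1 : (1 : ℝ) + T ≤ (M : ℝ) - 1 := by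
      have : ((2 + T : ℕ) : ℝ) ≤ M := by exact_mod_cast hM2
      push_cast at this; linarith
    have hT1 : 0 < (1 : ℝ) + T := by positivity
    calc π ^ 2 / ((M : ℝ) - 1) ≤ π ^ 2 / (1 + T) :=
          div_le_div_of_nonneg_left (by positivity) hT1 hM1
      _ ≤ ε := by
          rw [div_le_iff₀ hT1]
          have := (div_le_iff₀ hε).mp hT
          nlinarith
  rw [abs_le]
  constructor
  · linarith [boxHeight_ge hl hlL hLe]
  · linarith [boxHeight_le hl hlL]

end Box

end Summit.Ventures.LatticeQCDFlow.Theory2.Lattice.Flux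

end
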